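import Summits.CriticalPhenomena.CardyFormulaZ2.Theorems.CardyMagicRigidityNestingRigidityNeckZ2NodeProduct
import Literature.Probability.Percolation.ZdOneArmPowerBound
import Literature.Probability.Percolation.LatticeSymmetry
import HarnessLib

/-!
# Crux `NestingRigidity`, line `pinch-resampling` (v4), stub S12: big collar blobs touch the inner layer sparsely

Crux `Summit.CriticalPhenomena.CardyFormulaZ2.Theses.CardyMagicRigidity.NestingRigidity`
(stmt-CriticalPhenomena-4835), line `pinch-resampling` v4, stub S12 `stub_neckHookupCoarseZ2 : NeckHookupCoarseZ2`.
The second probabilistic primitive of the summation of the node events of `…NeckZ2ErrorCover` (with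
`…NeckZ2NodeProduct`, `…NeckZ2NodeCounting`): the locales of virtual edges are inner-layer vertices of BIG blobs
(sup diameter `≥ lam`), and DENSE clumps of locales — which carry no four-arm node event — are controlled instead
by the sparseness of such touch points.  Entirely from tree theorems (the a priori RSW one-arm bound
`exists_real_boxToFar_le_rpow_of_le_half`, `ZdOneArmPowerBound.lean`; translation invariance
`real_openCrossing_shift`; independence over disjoint pair sets `bondPercolation_real_biInter_eq_prod`):

* §1 `NeckCoarseZ2.zOneArmAt w r R` — an open crossing of the square annulus `zAnn w r R` (cluster form of one
  arm); it reads only the pairs of its annulus, is measurable, and `NeckCoarseZ2.zOneArmAt_of_bigBlob`: a blob of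
  sup diameter `≥ lam` through a vertex `c` with `|c - w|_∞ ≤ r` crosses `zAnn w (r+1) R` whenever
  `2 (R + r) ≤ lam` (on lattice configurations).
* §2 `NeckCoarseZ2.real_zOneArmAt_le` — `P_{1/2}(zOneArmAt w r R) ≤ C (r/(R-1))^α` (shift to the origin, then the
  a priori one-arm bound); `NeckCoarseZ2.real_biInter_zOneArmAt_eq_prod` — independence over disjoint annuli.
* §3 `real_forall_bigBlob_near_le_pow` (registered anchor): for annuli `zAnn (w i) (r+1) R` pairwise disjoint and
  `2 (R + r) ≤ lam`, the probability that EVERY `w i` has a big collar blob through a vertex within `r` of it is at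
  most `(C ((r+1)/(R-1))^α)^{#t}` — geometric decay in the number of windows of a dense touching run.
-/

noncomputable section

namespace Summit.CriticalPhenomena.CardyFormulaZ2.Cruxes.NestingRigidity.PinchResampling

open MeasureTheory Set Literature.Probability.Percolation Literature.Probability.LatticeModels
open ZPinchLocality

namespace NeckCoarseZ2

variable {ω : BondConfig (Site 2)}

/-! ## §1 One open arm across a square annulus, and big blobs -/

/-- **One open arm across `zAnn w r R`** (cluster form): an open path of the annulus from sup norm `r` to sup norm
`R` about `w`. -/
def zOneArmAt (w : Site 2) (r R : ℕ) : Set (BondConfig (Site 2)) :=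
  {ω | ∃ p q, zNorm (p - w) = r ∧ zNorm (q - w) = R ∧ PathIn (openGraph ω) (zAnn w r R) p q}

/-- The one-arm event reads only the pairs of its annulus. -/
theorem determinedBy_zOneArmAt (w : Site 2) (r R : ℕ) : DeterminedBy (zOneArmAt w r R) (zAnn w r R).sym2 := by
  rw [determinedBy_iff]
  intro ω ω' h
  have hc : ∀ a b, PathIn (openGraph ω) (zAnn w r R) a b ↔ PathIn (openGraph ω') (zAnn w r R) a b :=
    pathIn_congr (openGraph_adj_congr_of_inter_eq Subset.rfl h)
  simp only [zOneArmAt, mem_setOf_eq, hc]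

/-- The one-arm event is measurable. -/
theorem measurableSet_zOneArmAt (w : Site 2) (r R : ℕ) : MeasurableSet (zOneArmAt w r R) := by
  have h := determinedBy_zOneArmAt w r R
  rw [← (finite_sym2 (zAnn_finite w r R)).coe_toFinset] at h
  exact h.measurableSet_of_finset

/-- **A big blob near `w` crosses the annulus around `w`**: on a lattice configuration, if the collar blob of a
vertex `c` with `|c - w|_∞ ≤ r` has two vertices at sup distance `≥ lam`, then `zAnn w (r+1) R` is crossed by an open
path for every `R` with `r + 1 ≤ R` and `2 (R + r) ≤ lam`. -/
theorem zOneArmAt_of_bigBlob (hHG : ∀ a b, (openGraph ω).Adj a b → (zdGraph 2).Adj a b) {x c w : Site 2}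
    {s lam r R : ℕ} (hcw : zNorm (c - w) ≤ r) (hrR : r + 1 ≤ R) (hlam : 2 * (R + r) ≤ lam)
    (hbig : ∃ u ∈ blobOf (openGraph ω) (zBall x (2 * s) \ zBall x s) c,
      ∃ u' ∈ blobOf (openGraph ω) (zBall x (2 * s) \ zBall x s) c, (lam : ℤ) ≤ zNorm (u - u')) :
    ω ∈ zOneArmAt w (r + 1) R := by
  obtain ⟨u, hu, u', hu', hd⟩ := hbig
  -- one of `u`, `u'` is at sup distance `≥ R` from `w`
  have hfar : ∃ v ∈ blobOf (openGraph ω) (zBall x (2 * s) \ zBall x s) c, (R : ℤ) ≤ zNorm (v - w) := by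
    have h1 := zNorm_sub_le_add u c u'
    have h2 : zNorm (c - u') = zNorm (u' - c) := zNorm_sub_comm _ _
    have h3 := zNorm_sub_le_add u w c
    have h4 := zNorm_sub_le_add u' w c
    have h5 : zNorm (w - c) = zNorm (c - w) := zNorm_sub_comm _ _
    by_cases hu2 : (R : ℤ) ≤ zNorm (u - w)
    · exact ⟨u, hu, hu2⟩
    · refine ⟨u', hu', ?_⟩
      omega
  obtain ⟨v, hv, hvR⟩ := hfar
  obtain ⟨p₁, q₁, hp₁, hq₁, hcross, -⟩ :=
    exists_zAnn_crossing_of_pathIn hHG (r := r + 1) hrR (by push_cast; omega) hvR hv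
  exact ⟨p₁, q₁, hp₁, hq₁, hcross.mono inter_subset_right⟩

/-! ## §2 Probability: the a priori one-arm bound, moved to the centre `w`; independence -/

/-- The one-arm event is a sub-event of the translated "box to far" event of the tree. -/
theorem zOneArmAt_subset_openCrossing (w : Site 2) {r R : ℕ} (hR : 1 ≤ R) :
    zOneArmAt w r R ⊆ openCrossing ((· + w) '' (univ : Set (Site 2))) ((· + w) '' ↑(box 2 r))
      ((· + w) '' (↑(box 2 (R - 1)) : Set (Site 2))ᶜ) := by
  rintro ω ⟨p, q, hp, hq, hpath⟩
  refine ⟨p, ⟨p - w, ?_, sub_add_cancel p w⟩, q, ⟨q - w, ?_, sub_add_cancel q w⟩, ?_⟩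
  · rw [Finset.mem_coe, mem_box, Fin.forall_fin_two]
    rw [zNorm_sub] at hp
    have h0 := le_max_left |p 0 - w 0| |p 1 - w 1|
    have h1 := le_max_right |p 0 - w 0| |p 1 - w 1|
    rw [abs_le] at h0 h1
    simp only [Pi.sub_apply]
    omega
  · rw [mem_compl_iff, Finset.mem_coe, mem_box, Fin.forall_fin_two]
    rw [zNorm_sub] at hq
    simp only [Pi.sub_apply]
    intro hcon
    have h0 : |q 0 - w 0| ≤ ((R - 1 : ℕ) : ℤ) := abs_le.2 ⟨hcon.1.1, hcon.1.2⟩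
    have h1 : |q 1 - w 1| ≤ ((R - 1 : ℕ) : ℤ) := abs_le.2 ⟨hcon.2.1, hcon.2.2⟩
    have := max_le h0 h1
    omega
  · rw [image_univ_of_surjective (fun y ↦ ⟨y - w, sub_add_cancel y w⟩), DCT16.mem_openConnIn_iff_pathIn]
    exact hpath.mono (subset_univ _)

/-- **`P_{1/2}(one open arm across zAnn w r R) ≤ C (r/(R-1))^α`** with the constants of the tree's a priori
one-arm bound (`exists_real_boxToFar_le_rpow_of_le_half`), for all centres `w` and `1 ≤ r < R`. -/
theorem real_zOneArmAt_le : ∃ C α : ℝ, 0 < C ∧ 0 < α ∧ ∀ (w : Site 2) (r R : ℕ), 1 ≤ r → r + 1 ≤ R →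
    (bondPercolation (zdGraph 2) half).real (zOneArmAt w r R) ≤ C * ((r : ℝ) / ((R - 1 : ℕ) : ℝ)) ^ α := by
  obtain ⟨C, α, hC, hα, h⟩ := exists_real_boxToFar_le_rpow_of_le_half
  refine ⟨C, α, hC, hα, fun w r R hr hrR ↦ ?_⟩
  have hhalf : ((half : unitInterval) : ℝ) ≤ 1 / 2 := by rw [coe_half]
  calc (bondPercolation (zdGraph 2) half).real (zOneArmAt w r R)
      ≤ (bondPercolation (zdGraph 2) half).real (openCrossing ((· + w) '' (univ : Set (Site 2)))
          ((· + w) '' ↑(box 2 r)) ((· + w) '' (↑(box 2 (R - 1)) : Set (Site 2))ᶜ)) :=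
        measureReal_mono (zOneArmAt_subset_openCrossing w (by omega)) (measure_ne_top _ _)
    _ = (bondPercolation (zdGraph 2) half).real (openCrossing univ ↑(box 2 r) (↑(box 2 (R - 1)) : Set (Site 2))ᶜ) :=
        real_openCrossing_shift half w _ _ _
    _ ≤ C * ((r : ℝ) / ((R - 1 : ℕ) : ℝ)) ^ α := by
        have := h half hhalf r (R - 1) hr (by omega)
        simpa [openCrossing] using this

/-- **One-arm events across pairwise disjoint annuli are jointly independent under `P_{1/2}`.** -/
theorem real_biInter_zOneArmAt_eq_prod {ι : Type*} (t : Finset ι) (w : ι → Site 2) (r R : ι → ℕ)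
    (hdisj : (↑t : Set ι).PairwiseDisjoint fun i ↦ zAnn (w i) (r i) (R i)) :
    (bondPercolation (zdGraph 2) half).real (⋂ i ∈ t, zOneArmAt (w i) (r i) (R i)) =
      ∏ i ∈ t, (bondPercolation (zdGraph 2) half).real (zOneArmAt (w i) (r i) (R i)) :=
  bondPercolation_real_biInter_eq_prod (zdGraph 2) half t _ (fun i ↦ (zAnn (w i) (r i) (R i)).sym2)
    (fun i _ ↦ determinedBy_zOneArmAt (w i) (r i) (R i)) (fun i _ ↦ measurableSet_zOneArmAt (w i) (r i) (R i))
    fun _ hi _ hj hij ↦ disjoint_sym2_of_disjoint (hdisj hi hj hij)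

end NeckCoarseZ2

/-! ## §3 Dense touching by big blobs decays geometrically -/

/-- **Big collar blobs touch prescribed windows only at a geometric cost (registered helper, anchor of this module on
the crux item).**  With the constants `C, α > 0` of the tree's a priori one-arm bound: for every finite family of
centres `w i` whose annuli `zAnn (w i) (r+1) R` are pairwise disjoint, `1 ≤ r`, `r + 2 ≤ R`, `2 (R + r) ≤ lam`, the
probability that for EVERY `i` some vertex within sup distance `r` of `w i` lies in a collar blob (of the collar
`Λ_{2s}(x) ∖ Λ_s(x)`) of sup diameter `≥ lam` is at most `(C ((r+1)/(R-1))^α)^{#t}`. -/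
theorem real_forall_bigBlob_near_le_pow : ∃ C α : ℝ, 0 < C ∧ 0 < α ∧ ∀ (ι : Type) (t : Finset ι) (w : ι → Site 2) (x : Site 2) (s lam r R : ℕ), 1 ≤ r → r + 2 ≤ R → 2 * (R + r) ≤ lam → (↑t : Set ι).PairwiseDisjoint (fun i ↦ NeckCoarseZ2.zAnn (w i) (r + 1) R) → (bondPercolation (zdGraph 2) half).real (⋂ i ∈ t, {ω | ∃ c : Site 2, zNorm (c - w i) ≤ r ∧ ∃ u ∈ blobOf (openGraph ω) (zBall x (2 * s) \ zBall x s) c, ∃ u' ∈ blobOf (openGraph ω) (zBall x (2 * s) \ zBall x s) c, (lam : ℤ) ≤ zNorm (u - u')}) ≤ (C * (((r + 1 : ℕ) : ℝ) / ((R - 1 : ℕ) : ℝ)) ^ α) ^ t.card := by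
  obtain ⟨C, α, hC, hα, h1⟩ := NeckCoarseZ2.real_zOneArmAt_le
  refine ⟨C, α, hC, hα, fun ι t w x s lam r R hr hrR hlam hdisj ↦ ?_⟩
  set μ := bondPercolation (zdGraph 2) half with hμ
  set E : ι → Set (BondConfig (Site 2)) := fun i ↦ {ω | ∃ c : Site 2, zNorm (c - w i) ≤ r ∧
    ∃ u ∈ blobOf (openGraph ω) (zBall x (2 * s) \ zBall x s) c,
      ∃ u' ∈ blobOf (openGraph ω) (zBall x (2 * s) \ zBall x s) c, (lam : ℤ) ≤ zNorm (u - u')} with hE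
  -- off a null set the touch events imply the one-arm events
  have hcover : (⋂ i ∈ t, E i) ∩ {ω | ω ⊆ (zdGraph 2).edgeSet} ⊆ ⋂ i ∈ t, NeckCoarseZ2.zOneArmAt (w i) (r + 1) R := by
    rintro ω ⟨hω, hlat⟩
    have hHG : ∀ a b, (openGraph ω).Adj a b → (zdGraph 2).Adj a b := fun a b h ↦
      (SimpleGraph.mem_edgeSet _).1 (hlat ((openGraph_adj ω a b).1 h).1)
    simp only [mem_iInter] at hω ⊢
    intro i hi
    obtain ⟨c, hcw, hbig⟩ := hω i hi
    exact NeckCoarseZ2.zOneArmAt_of_bigBlob hHG hcw (by omega) hlam hbig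
  have hae : ∀ᵐ ω ∂μ, ω ⊆ (zdGraph 2).edgeSet := ae_subset_edgeSet (zdGraph 2) half
  have heq : μ.real (⋂ i ∈ t, E i) = μ.real ((⋂ i ∈ t, E i) ∩ {ω | ω ⊆ (zdGraph 2).edgeSet}) := by
    refine measureReal_congr (Filter.eventuallyEq_set.2 (hae.mono fun ω hω ↦ ?_))
    simp only [mem_inter_iff, mem_setOf_eq, hω, and_true]
  rw [heq]
  calc μ.real ((⋂ i ∈ t, E i) ∩ {ω | ω ⊆ (zdGraph 2).edgeSet})
      ≤ μ.real (⋂ i ∈ t, NeckCoarseZ2.zOneArmAt (w i) (r + 1) R) := measureReal_mono hcover (measure_ne_top _ _)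
    _ = ∏ i ∈ t, μ.real (NeckCoarseZ2.zOneArmAt (w i) (r + 1) R) :=
        NeckCoarseZ2.real_biInter_zOneArmAt_eq_prod t w (fun _ ↦ r + 1) (fun _ ↦ R) hdisj
    _ ≤ ∏ _i ∈ t, C * (((r + 1 : ℕ) : ℝ) / ((R - 1 : ℕ) : ℝ)) ^ α := by
        refine Finset.prod_le_prod (fun i _ ↦ measureReal_nonneg) fun i _ ↦ ?_
        exact_mod_cast h1 (w i) (r + 1) R (by omega) (by omega)
    _ = (C * (((r + 1 : ℕ) : ℝ) / ((R - 1 : ℕ) : ℝ)) ^ α) ^ t.card := Finset.prod_const _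

end Summit.CriticalPhenomena.CardyFormulaZ2.Cruxes.NestingRigidity.PinchResampling

end
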